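import Summits.BirchSwinnertonDyer.BirchSwinnertonDyer.Theorems.BiquadraticEisensteinDescentHeegnerTwistCouplingInSupplySymbolicMonskyOddDesignNoSeven
import HarnessLib

set_option linter.dupNamespace false -- `Summit.BirchSwinnertonDyer.BirchSwinnertonDyer.Theorems.…` (summit = sub)
set_option autoImplicit false

/-!
# Crux `HeegnerTwistCouplingInSupply` (stmt-BirchSwinnertonDyer-21381) — ODD bases with EXACTLY ONE prime `≡ 7 (mod 8)`:
# at `δ = 1` the `0 × V` section of the augmented kernel never obstructs (odd (★) on this family)

Route `BiquadraticEisensteinDescent` (cell `pub/bsd-wall`, width seat `bsd-wall-cm-bed-w3` g25; `--supports` 21381, helper). Companion of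
`…SymbolicMonskyOddDesignNoSeven` (p760030: no prime `≡ 7 (mod 8)`). For a root-number-`−1` odd base with exactly one prime `P_{b₇} ≡ 7 (mod 8)`:
* `swap_mem_augKernel_one_inf_ker_snd_of_one_seven` — if `(0, w) ∈ 𝒦⁺(1)` with `⟨m, w⟩ = 0` then `(w, 0) ∈ 𝒦⁺(1)`: writing
  `(0, w) = (γ·1, y) + γ(1,1)`, the first kernel equation at `b₇` (`d_{b₇} = 0`, `m_{b₇} = 1`) gives `γ = 0`, so `w = y ∈ ker L ∩ ker D_d`;
  its class-3 coordinates vanish (`D`), and its single class-7 coordinate is `⟨m, y⟩ = 0`; hence `y|_M = 0` and `(y, 0) ∈ 𝒦`.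
* ★★ `two_mul_finrank_augKernel_one_inf_ker_fst_le_of_one_seven` — `2·dim (𝒦⁺(1) ∩ 0×V) ≤ dim 𝒦 + 1` (one side condition, disjointness in
  `𝒦⁺(1)`, kernel parity). Numerics (w3 g25 probe32.py): 3 047 odd bases with one prime `≡ 7 (mod 8)`, 0 failures. (The diagonal bound of
  `…OddDesignNoSeven` does NOT extend to this family: 99 failures in the same sample.)
HONEST FRAMING: RUNG-LEVEL corner layer; `𝔽₂`-linear algebra attached to Monsky matrices [cite: HeathBrown1994SelmerCongruentII, Appendix (Monsky),
typescript pp. 39–41]; the crux as stated (C⁺), its registered stubs and BSD are NOT touched; nothing is closed. THEOREMS ONLY.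
-/

namespace Summit.BirchSwinnertonDyer.BirchSwinnertonDyer.Theorems.SymbolicMonsky

section OneSevenOdd

open Module Matrix Literature.NumberTheory.EllipticCurves Literature.NumberTheory.EllipticCurves.HeathBrown1994
  Literature.NumberTheory.EllipticCurves.HeathBrown1994.Families
open Literature.NumberTheory.EllipticCurves.Rank1Residual

variable {k : ℕ} (base : SymbData (k + 1))

/-- Cutting a subspace by one linear functional costs at most one dimension. -/
private theorem finrank_le_finrank_inf_ker_add_one_o7 {Z : Type*} [AddCommGroup Z] [Module (ZMod 2) Z] [FiniteDimensional (ZMod 2) Z]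
    (C : Submodule (ZMod 2) Z) (f : Z →ₗ[ZMod 2] ZMod 2) :
    finrank (ZMod 2) ↥C ≤ finrank (ZMod 2) ↥(C ⊓ LinearMap.ker f) + 1 := by
  have h1 := Submodule.finrank_sup_add_finrank_inf_eq C (LinearMap.ker f)
  have h2 := LinearMap.finrank_range_add_finrank_ker f
  have h3 : finrank (ZMod 2) ↥(LinearMap.range f) ≤ 1 := by
    have := Submodule.finrank_le (LinearMap.range f)
    rwa [Module.finrank_self] at this
  have h4 : finrank (ZMod 2) ↥(C ⊔ LinearMap.ker f) ≤ finrank (ZMod 2) Z := Submodule.finrank_le _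
  omega

/-- Elements of the augmented kernel at `δ = 1`: `(x + γ·1, y + γ·1)` for a virtual kernel pair `(x, y)` and `γ ∈ 𝔽₂`. -/
private theorem mem_augKernel_one_iff_o7 (p : (Fin (k + 1) → ZMod 2) × (Fin (k + 1) → ZMod 2)) :
    p ∈ base.augKernel (fun _ => 1) ↔
      ∃ (x y : Fin (k + 1) → ZMod 2) (γ : ZMod 2), (x, y) ∈ base.virtualKernel ∧ p = (fun b => x b + γ, fun b => y b + γ) := by
  constructor
  · intro hp
    obtain ⟨q, hq, γ, rfl⟩ := exists_of_mem_augKernel base (fun _ => 1) hp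
    refine ⟨q.1, q.2, γ, hq, Prod.ext ?_ ?_⟩
    · funext b; simp
    · funext b; simp
  · rintro ⟨x, y, γ, hxy, rfl⟩
    have h := add_smul_mem_augKernel base (fun _ => 1) hxy γ
    have e : ((x, y) : (Fin (k + 1) → ZMod 2) × (Fin (k + 1) → ZMod 2)) + γ • ((fun _ => (1 : ZMod 2)), fun _ => (1 : ZMod 2)) =
        (fun b => x b + γ, fun b => y b + γ) := Prod.ext (funext fun b => by simp) (funext fun b => by simp)
    rw [e] at h
    exact h

/-- **MECHANISM (h2, exactly one prime `≡ 7 (mod 8)`).** If `(0, w) ∈ 𝒦⁺(1)` and `⟨m, w⟩ = 0`, then `(w, 0) ∈ 𝒦⁺(1)`.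
[cite: HeathBrown1994SelmerCongruentII, Appendix (Monsky), typescript pp. 39–41] -/
theorem swap_mem_augKernel_one_inf_ker_snd_of_one_seven
    (b₇ : Fin (k + 1)) (hb₇ : negNegOne (base.cls b₇) = true) (hb₇' : negTwo (base.cls b₇) = false)
    (h71 : ∀ b, negNegOne (base.cls b) = true → negTwo (base.cls b) = false → b = b₇)
    (p : (Fin (k + 1) → ZMod 2) × (Fin (k + 1) → ZMod 2))
    (hp : p ∈ base.augKernel (fun _ => 1) ⊓ LinearMap.ker (LinearMap.fst (ZMod 2) (Fin (k + 1) → ZMod 2) (Fin (k + 1) → ZMod 2)))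
    (hm : (∑ b, bz (negNegOne (base.cls b)) * p.2 b) = 0) :
    ((p.2, 0) : (Fin (k + 1) → ZMod 2) × (Fin (k + 1) → ZMod 2)) ∈
      base.augKernel (fun _ => 1) ⊓ LinearMap.ker (LinearMap.snd (ZMod 2) (Fin (k + 1) → ZMod 2) (Fin (k + 1) → ZMod 2)) := by
  have h2 : ∀ x : ZMod 2, x + x = 0 := by decide
  obtain ⟨hpW, hp0⟩ := Submodule.mem_inf.1 hp
  obtain ⟨x, y, γ, hxy, rfl⟩ := (mem_augKernel_one_iff_o7 base p).1 hpW
  rw [LinearMap.mem_ker, LinearMap.fst_apply] at hp0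
  have hx : ∀ b, x b = γ := fun b => by
    have := congrFun hp0 b
    simp only [Pi.zero_apply] at this
    linear_combination this - h2 γ
  simp only at hm ⊢
  obtain ⟨hE1, hE2⟩ := (mem_virtualKernel_iff base (x, y)).1 hxy
  have e1 : ∀ i, bz (negTwo (base.cls i)) * y i + bz (negNegOne (base.cls i)) * γ = 0 := fun i => by
    have e := hE1 i
    simp only [hx, lap_const, zero_add] at e
    linear_combination e
  have e2 : ∀ i, (∑ j, bz (base.neg i j) * (y j + y i)) + bz (negNegOne (base.cls i)) * γ = 0 := fun i => by
    have e := hE2 i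
    simp only [hx] at e
    linear_combination e
  -- at the prime `≡ 7 (mod 8)`: `γ = 0`
  have hγ : γ = 0 := by
    have e := e1 b₇
    rw [hb₇, hb₇'] at e
    have h0 : bz false = 0 := rfl
    have h1 : bz true = 1 := rfl
    rw [h0, h1, zero_mul, zero_add, one_mul] at e
    exact e
  have hdy : ∀ i, bz (negTwo (base.cls i)) * y i = 0 := fun i => by
    have e := e1 i
    rw [hγ, mul_zero, add_zero] at e
    exact e
  have hlap : ∀ i, (∑ j, bz (base.neg i j) * (y j + y i)) = 0 := fun i => by
    have e := e2 i
    rw [hγ, mul_zero, add_zero] at e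
    exact e
  have hw : (fun b => y b + γ) = y := funext fun b => by rw [hγ, add_zero]
  rw [hw]
  simp only [hγ, add_zero] at hm
  -- `y|_M = 0`: class-3 coordinates from `d_i y_i = 0`, the class-7 coordinate by the parity `⟨m, y⟩ = 0`
  have hmy' : ∀ i, i ≠ b₇ → bz (negNegOne (base.cls i)) * y i = 0 := fun i hi7 => by
    cases hi : negNegOne (base.cls i) with
    | false => exact zero_mul _
    | true =>
      cases hd : negTwo (base.cls i) with
      | true => have := hdy i; rw [hd] at this; exact this
      | false => exact absurd (h71 i hi hd) hi7
  have hmy : ∀ i, bz (negNegOne (base.cls i)) * y i = 0 := fun i => by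
    by_cases hi7 : i = b₇
    · have hs := hm
      rw [Finset.sum_eq_single b₇ (fun j _ hj => hmy' j hj) (fun h => absurd (Finset.mem_univ _) h)] at hs
      rw [hi7]; exact hs
    · exact hmy' i hi7
  have hy0 : (y, (0 : Fin (k + 1) → ZMod 2)) ∈ base.virtualKernel := by
    rw [mem_virtualKernel_iff]
    refine ⟨fun i => ?_, fun i => ?_⟩
    · simp only [Pi.zero_apply, mul_zero, add_zero]
      linear_combination hlap i + hmy i
    · simp only [Pi.zero_apply, add_zero, mul_zero, Finset.sum_const_zero]
      exact hmy i
  refine Submodule.mem_inf.2 ⟨?_, by rw [LinearMap.mem_ker, LinearMap.snd_apply]⟩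
  rw [mem_augKernel_one_iff_o7]
  exact ⟨y, 0, 0, hy0, Prod.ext (funext fun b => by simp) (funext fun b => by simp)⟩

/-- ★★ **Odd (★) on bases with exactly one prime `≡ 7 (mod 8)`**: `2 · dim (𝒦⁺(1) ∩ 0×V) ≤ dim 𝒦 + 1` (`= 2τ₀` by `odd_finrank_virtualKernel`).
[cite: HeathBrown1994SelmerCongruentII, Appendix (Monsky), typescript pp. 39–41] -/
theorem two_mul_finrank_augKernel_one_inf_ker_fst_le_of_one_seven
    (b₇ : Fin (k + 1)) (hb₇ : negNegOne (base.cls b₇) = true) (hb₇' : negTwo (base.cls b₇) = false)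
    (h71 : ∀ b, negNegOne (base.cls b) = true → negTwo (base.cls b) = false → b = b₇)
    (hroot : (∑ b, (bz (negNegOne (base.cls b)) + bz (negTwo (base.cls b)))) = 1) :
    2 * finrank (ZMod 2) ↥(base.augKernel (fun _ => 1) ⊓
        LinearMap.ker (LinearMap.fst (ZMod 2) (Fin (k + 1) → ZMod 2) (Fin (k + 1) → ZMod 2))) ≤
      finrank (ZMod 2) ↥base.virtualKernel + 1 := by
  set W := base.augKernel (fun _ => 1) with hWdef
  set C := W ⊓ LinearMap.ker (LinearMap.fst (ZMod 2) (Fin (k + 1) → ZMod 2) (Fin (k + 1) → ZMod 2)) with hC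
  set A := W ⊓ LinearMap.ker (LinearMap.snd (ZMod 2) (Fin (k + 1) → ZMod 2) (Fin (k + 1) → ZMod 2)) with hA
  obtain ⟨φm, hφm⟩ := exists_dot_dual (k := k) (fun b => bz (negNegOne (base.cls b)))
  set fm := φm.comp (LinearMap.snd (ZMod 2) (Fin (k + 1) → ZMod 2) (Fin (k + 1) → ZMod 2)) with hfm
  set C₀ := C ⊓ LinearMap.ker fm with hC₀
  set e := LinearEquiv.prodComm (ZMod 2) (Fin (k + 1) → ZMod 2) (Fin (k + 1) → ZMod 2) with he
  have hC₀A : C₀.map e.toLinearMap ≤ A := by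
    intro q hq
    obtain ⟨p, hp, rfl⟩ := Submodule.mem_map.1 hq
    obtain ⟨hpC, hpm⟩ := Submodule.mem_inf.1 hp
    have hp0 : p.1 = 0 := by
      have := (Submodule.mem_inf.1 hpC).2
      rwa [LinearMap.mem_ker, LinearMap.fst_apply] at this
    have hm : (∑ b, bz (negNegOne (base.cls b)) * p.2 b) = 0 := by
      rw [LinearMap.mem_ker, hfm, LinearMap.comp_apply, LinearMap.snd_apply, hφm] at hpm
      exact hpm
    have hsw : e.toLinearMap p = (p.2, 0) := by
      rw [LinearEquiv.coe_toLinearMap, he, LinearEquiv.prodComm_apply, Prod.swap, hp0]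
    rw [hsw]
    exact swap_mem_augKernel_one_inf_ker_snd_of_one_seven base b₇ hb₇ hb₇' h71 p hpC hm
  have hle₁ : finrank (ZMod 2) ↥(C₀.map e.toLinearMap) ≤ finrank (ZMod 2) ↥A := Submodule.finrank_mono hC₀A
  rw [← LinearEquiv.finrank_eq (Submodule.equivMapOfInjective _ e.injective C₀)] at hle₁
  have hcod₁ : finrank (ZMod 2) ↥C ≤ finrank (ZMod 2) ↥C₀ + 1 := finrank_le_finrank_inf_ker_add_one_o7 C fm
  have hCA : C ⊓ A = ⊥ := by
    rw [Submodule.eq_bot_iff]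
    intro p hp
    obtain ⟨hpC, hpA⟩ := Submodule.mem_inf.1 hp
    have h1 : p.1 = 0 := by
      have := (Submodule.mem_inf.1 hpC).2
      rwa [LinearMap.mem_ker, LinearMap.fst_apply] at this
    have hp2 : p.2 = 0 := by
      have := (Submodule.mem_inf.1 hpA).2
      rwa [LinearMap.mem_ker, LinearMap.snd_apply] at this
    exact Prod.ext h1 hp2
  have hsup : C ⊔ A ≤ W := sup_le inf_le_left inf_le_left
  have hW : finrank (ZMod 2) ↥W = finrank (ZMod 2) ↥base.virtualKernel + 1 :=
    finrank_augKernel_eq base (fun _ => 1) (one_one_not_mem_virtualKernel base hroot)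
  have hsum := Submodule.finrank_sup_add_finrank_inf_eq C A
  rw [hCA, finrank_bot, add_zero] at hsum
  have hmono := Submodule.finrank_mono hsup
  obtain ⟨r, hr⟩ := odd_finrank_virtualKernel base hroot
  omega

end OneSevenOdd

end Summit.BirchSwinnertonDyer.BirchSwinnertonDyer.Theorems.SymbolicMonsky
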